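import Literature.AlgebraicGeometry.Motives.IntegralModelSection
import Literature.AlgebraicGeometry.Motives.AbelianVarietyGoodReductionFrobenius
import Literature.AlgebraicGeometry.Motives.AbelianVarietyMulN
import HarnessLib

/-!
# The zero section of the good-reduction model of an abelian variety (bare model, no group law)

Topic `Literature/AlgebraicGeometry/Motives`, namespace `Literature.AlgebraicGeometry.Motives.AbelianVariety.GoodReductionAt`.
THEOREMS ONLY; no definition, no named fact (net Literature debt **0**).  Written for the cell `hodgecm-mathlib` (D-0151), E2 line
(A-p02's P1-SPEC / ALLOCATION v1.5), piece **(α)**: for a good-reduction datum `R : A.GoodReductionAt 𝔓` of an abelian variety `A`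
over a number field `k` — whose `R.model` is a BARE smooth proper `IntegralModel` over `O = 𝓞_{k,𝔓}` (no group law: that is the
floor's `r₀`) — the three inputs consumed verbatim by A-p03's (β1) `exists_cotangentLattice_conj`:

* `exists_zeroSection` — the ZERO SECTION `e : Spec O → R.model.total` (valuative criterion of properness applied to the origin
  `Spec k → A`, `IntegralModelSection.exists_section_of_point`): `e ≫ (𝒳 → Spec O) = 𝟙` and its generic point is the origin of
  `A` read in the model (`hgen`);
* `zeroSection_comp_liftEnd_left` — `e ≫ R.liftEnd u = e` for every `u ∈ End A` (`hev`): the generic point of `e ≫ R.liftEnd u`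
  is `u(origin) = origin` (`liftEnd_left_comp`, `unitPt_comp_toSchemeHom`), and sections with the same generic point agree
  (`section_comp_left_eq_of_generic`, separatedness);
* `unitPt_reduction_comp_eq` — the ORIGIN PIN (`hsp`): the closed point of `e`, read in `R.reduction` through `reductionIso`, IS the
  origin of the abelian variety `R.reduction`.  Proof: that `κ(𝔓)`-point `ē` is fixed by the reduction of EVERY endomorphism
  (it is the specialisation of `e`, which every `R.liftEnd u` fixes; `redEnd_left_comp`); for `u = 2` the reduction is
  `[2] = (𝟙)^2` in the group of points (`hom_zsmul_id`, `R.redEnd` a ring map), and a point `x` with `x² = x` is the unit.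

Statements spell `κ(𝔓)` as an `O`-algebra by the explicit ring map `residueAt 𝔓` (no global instance), as A-p03's file does.

## References
* [Shimura1998] G. Shimura, *Abelian Varieties with Complex Multiplication and Modular Functions*, §11.1 (reduction of an abelian
  variety and of its endomorphisms, Prop. 12), §18.6 p. 129.
* [BoschLutkebohmertRaynaud1990] S. Bosch, W. Lütkebohmert, M. Raynaud, *Néron Models*, §1.1 (`𝒳(R) = 𝒳_K(K)` for proper `𝒳`),
  §1.2 Prop. 8 (abelian schemes are Néron models: endomorphisms extend).
* [SerreTate1968] J.-P. Serre, J. Tate, *Good reduction of abelian varieties*, §1.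
* [Hartshorne1977] R. Hartshorne, *Algebraic Geometry*, II Thm. 4.7.
-/

noncomputable section

-- Compositions through `((baseChange O k).obj X).left = pullback X.hom _` are definitional only above `instances` transparency.
set_option backward.isDefEq.respectTransparency false

open CategoryTheory CategoryTheory.Limits AlgebraicGeometry IsDedekindDomain IsDedekindDomain.HeightOneSpectrum
open scoped MonObj

namespace Literature.AlgebraicGeometry.Motives

namespace AbelianVariety

namespace GoodReductionAt

open scoped NumberField

variable {k : Type} [Field k] [NumberField k] {A : AbelianVariety k} {𝔓 : HeightOneSpectrum (𝓞 k)} (R : A.GoodReductionAt 𝔓)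

/-- The good-reduction model is proper over `𝓞_{k,𝔓}`. [cite: SerreTate1968, §1] -/
theorem isProper_model_hom : IsProper R.model.total.hom := R.isSmoothProper.2

/-- The good-reduction model is separated over `𝓞_{k,𝔓}`. [cite: SerreTate1968, §1] -/
theorem isSeparated_model_hom : IsSeparated R.model.total.hom :=
  haveI := R.isProper_model_hom
  inferInstance

/-- **The zero section of the good-reduction model** (valuative criterion of properness applied to the origin of `A`): a section
`e : Spec 𝓞_{k,𝔓} → R.model.total` whose generic point is the origin of `A`, read in the model through `genericIso⁻¹` and the
projection `R.model.total ×_O k → R.model.total`. [cite: BoschLutkebohmertRaynaud1990, §1.1] [cite: Hartshorne1977, II Thm. 4.7] -/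
theorem exists_zeroSection :
    ∃ e : Spec (.of (valuationSubringAtPrime k 𝔓)) ⟶ R.model.total.left, e ≫ R.model.total.hom = 𝟙 _ ∧
      Spec.map (CommRingCat.ofHom (algebraMap (valuationSubringAtPrime k 𝔓) k)) ≫ e =
        unitPt A ≫ R.model.genericIso.inv.left ≫ baseChangeHomFst (algebraMap (valuationSubringAtPrime k 𝔓) k) R.model.total := by
  haveI := R.isProper_model_hom
  exact R.model.exists_section_of_point (unitPt A) (unitPt_comp_hom (B := A))

variable (e : Spec (.of (valuationSubringAtPrime k 𝔓)) ⟶ R.model.total.left) (he : e ≫ R.model.total.hom = 𝟙 _)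
  (hgen : Spec.map (CommRingCat.ofHom (algebraMap (valuationSubringAtPrime k 𝔓) k)) ≫ e =
    unitPt A ≫ R.model.genericIso.inv.left ≫ baseChangeHomFst (algebraMap (valuationSubringAtPrime k 𝔓) k) R.model.total)

/-- On underlying schemes, the generic fibre of `R.liftEnd u` is `genericIso ∘ u ∘ genericIso⁻¹` (`liftEnd_left_comp` rearranged).
[cite: BoschLutkebohmertRaynaud1990, §1.2 Prop. 8] -/
theorem baseChange_map_liftEnd_left (u : End A) :
    ((_root_.Literature.AlgebraicGeometry.Motives.baseChange (valuationSubringAtPrime k 𝔓) k).map (R.liftEnd u)).left =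
      R.model.genericIso.hom.left ≫ Hom.toSchemeHom (u : A ⟶ A) ≫ R.model.genericIso.inv.left := by
  have h := R.liftEnd_left_comp u
  have hhi : R.model.genericIso.hom.left ≫ R.model.genericIso.inv.left = 𝟙 _ := by
    rw [← Over.comp_left, Iso.hom_inv_id, Over.id_left]
  calc ((_root_.Literature.AlgebraicGeometry.Motives.baseChange (valuationSubringAtPrime k 𝔓) k).map (R.liftEnd u)).left
      = (((_root_.Literature.AlgebraicGeometry.Motives.baseChange (valuationSubringAtPrime k 𝔓) k).map (R.liftEnd u)).left ≫ R.model.genericIso.hom.left) ≫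
          R.model.genericIso.inv.left := by rw [Category.assoc, hhi, Category.comp_id]
    _ = R.model.genericIso.hom.left ≫ Hom.toSchemeHom (u : A ⟶ A) ≫ R.model.genericIso.inv.left := by
          rw [h, Category.assoc]

include hgen in
/-- The generic point of the zero section is fixed by (the generic fibre of) every lifted endomorphism `R.liftEnd u`:
`(Spec k → Spec O → 𝒳) ≫ R.liftEnd u = (Spec k → Spec O → 𝒳)`, because `u` fixes the origin of `A`.
[cite: BoschLutkebohmertRaynaud1990, §1.2 Prop. 8] [cite: Shimura1998, §11.1 Prop. 12] -/
theorem zeroSection_generic_comp_liftEnd_left (u : End A) :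
    (Spec.map (CommRingCat.ofHom (algebraMap (valuationSubringAtPrime k 𝔓) k)) ≫ e) ≫ (R.liftEnd u).left =
      Spec.map (CommRingCat.ofHom (algebraMap (valuationSubringAtPrime k 𝔓) k)) ≫ e := by
  rw [hgen, Category.assoc, Category.assoc]
  -- `pr ≫ (liftEnd u) = (liftEnd u)_k ≫ pr` and `(liftEnd u)_k = genericIso ∘ u ∘ genericIso⁻¹`
  have hnat : baseChangeHomFst (algebraMap (valuationSubringAtPrime k 𝔓) k) R.model.total ≫ (R.liftEnd u).left =
      ((_root_.Literature.AlgebraicGeometry.Motives.baseChange (valuationSubringAtPrime k 𝔓) k).map (R.liftEnd u)).left ≫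
        baseChangeHomFst (algebraMap (valuationSubringAtPrime k 𝔓) k) R.model.total :=
    (baseChangeHom_map_left_comp_fst (algebraMap (valuationSubringAtPrime k 𝔓) k) (R.liftEnd u)).symm
  have hih : R.model.genericIso.inv.left ≫ R.model.genericIso.hom.left = 𝟙 _ := by
    rw [← Over.comp_left, Iso.inv_hom_id, Over.id_left]
  have hfix : unitPt A ≫ Hom.toSchemeHom (u : A ⟶ A) = unitPt A := unitPt_comp_toSchemeHom (u : A ⟶ A)
  -- `genericIso⁻¹ ≫ (liftEnd u)_k = u ≫ genericIso⁻¹`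
  have hkey : R.model.genericIso.inv.left ≫
        ((_root_.Literature.AlgebraicGeometry.Motives.baseChange (valuationSubringAtPrime k 𝔓) k).map (R.liftEnd u)).left =
      Hom.toSchemeHom (u : A ⟶ A) ≫ R.model.genericIso.inv.left :=
    calc R.model.genericIso.inv.left ≫
          ((_root_.Literature.AlgebraicGeometry.Motives.baseChange (valuationSubringAtPrime k 𝔓) k).map (R.liftEnd u)).left
        = R.model.genericIso.inv.left ≫ (R.model.genericIso.hom.left ≫ Hom.toSchemeHom (u : A ⟶ A) ≫ R.model.genericIso.inv.left) :=
          congrArg (fun t => R.model.genericIso.inv.left ≫ t) (R.baseChange_map_liftEnd_left u)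
      _ = (R.model.genericIso.inv.left ≫ R.model.genericIso.hom.left) ≫ (Hom.toSchemeHom (u : A ⟶ A) ≫ R.model.genericIso.inv.left) :=
          (Category.assoc _ _ _).symm
      _ = 𝟙 _ ≫ (Hom.toSchemeHom (u : A ⟶ A) ≫ R.model.genericIso.inv.left) := congrArg (fun t => t ≫ _) hih
      _ = Hom.toSchemeHom (u : A ⟶ A) ≫ R.model.genericIso.inv.left := Category.id_comp _
  -- `genericIso⁻¹ ≫ pr ≫ liftEnd u = u ≫ genericIso⁻¹ ≫ pr`
  have hstep : R.model.genericIso.inv.left ≫ baseChangeHomFst (algebraMap (valuationSubringAtPrime k 𝔓) k) R.model.total ≫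
        (R.liftEnd u).left =
      Hom.toSchemeHom (u : A ⟶ A) ≫ R.model.genericIso.inv.left ≫
        baseChangeHomFst (algebraMap (valuationSubringAtPrime k 𝔓) k) R.model.total :=
    calc R.model.genericIso.inv.left ≫ baseChangeHomFst (algebraMap (valuationSubringAtPrime k 𝔓) k) R.model.total ≫
          (R.liftEnd u).left
        = R.model.genericIso.inv.left ≫
            (((_root_.Literature.AlgebraicGeometry.Motives.baseChange (valuationSubringAtPrime k 𝔓) k).map (R.liftEnd u)).left ≫
              baseChangeHomFst (algebraMap (valuationSubringAtPrime k 𝔓) k) R.model.total) :=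
          congrArg (fun t => R.model.genericIso.inv.left ≫ t) hnat
      _ = (R.model.genericIso.inv.left ≫
            ((_root_.Literature.AlgebraicGeometry.Motives.baseChange (valuationSubringAtPrime k 𝔓) k).map (R.liftEnd u)).left) ≫
              baseChangeHomFst (algebraMap (valuationSubringAtPrime k 𝔓) k) R.model.total := (Category.assoc _ _ _).symm
      _ = (Hom.toSchemeHom (u : A ⟶ A) ≫ R.model.genericIso.inv.left) ≫
              baseChangeHomFst (algebraMap (valuationSubringAtPrime k 𝔓) k) R.model.total := congrArg (fun t => t ≫ _) hkey
      _ = Hom.toSchemeHom (u : A ⟶ A) ≫ R.model.genericIso.inv.left ≫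
            baseChangeHomFst (algebraMap (valuationSubringAtPrime k 𝔓) k) R.model.total := Category.assoc _ _ _
  calc unitPt A ≫ R.model.genericIso.inv.left ≫ baseChangeHomFst (algebraMap (valuationSubringAtPrime k 𝔓) k) R.model.total ≫
        (R.liftEnd u).left
      = unitPt A ≫ (Hom.toSchemeHom (u : A ⟶ A) ≫ R.model.genericIso.inv.left ≫
          baseChangeHomFst (algebraMap (valuationSubringAtPrime k 𝔓) k) R.model.total) := congrArg (fun t => unitPt A ≫ t) hstep
    _ = (unitPt A ≫ Hom.toSchemeHom (u : A ⟶ A)) ≫ R.model.genericIso.inv.left ≫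
          baseChangeHomFst (algebraMap (valuationSubringAtPrime k 𝔓) k) R.model.total := (Category.assoc _ _ _).symm
    _ = unitPt A ≫ R.model.genericIso.inv.left ≫ baseChangeHomFst (algebraMap (valuationSubringAtPrime k 𝔓) k) R.model.total :=
          congrArg (fun t => t ≫ _) hfix

include he hgen in
/-- **`e ≫ R.liftEnd u = e`**: every lifted endomorphism of the model fixes the zero section (both sides are sections of the
separated model with the same generic point). [cite: BoschLutkebohmertRaynaud1990, §1.1 and §1.2 Prop. 8] -/
theorem zeroSection_comp_liftEnd_left (u : End A) : e ≫ (R.liftEnd u).left = e :=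
  haveI := R.isSeparated_model_hom
  R.model.section_comp_left_eq_of_generic e he (R.liftEnd u) (R.zeroSection_generic_comp_liftEnd_left e hgen u)

/-! ### The origin pin: the closed point of the zero section is the origin of `R.reduction` -/

include he in
/-- The closed point of the zero section, as a `κ(𝔓)`-point of the special fibre `R.model.reductionAt = R.model.total ×_O κ(𝔓)`:
the lift of `(Spec κ(𝔓) → Spec O → 𝒳, 𝟙)` to the fibre product — here through its defining property only: a morphism
`ē' : Spec κ(𝔓) → reductionAt` with `ē' ≫ pr = Spec (residueAt) ≫ e` and `ē' ≫ (reductionAt → Spec κ) = 𝟙` EXISTS.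
[cite: SerreTate1968, §1] -/
theorem exists_specialPoint :
    ∃ ē' : Spec (.of 𝔓.asIdeal.ResidueField) ⟶ R.model.reductionAt.left,
      ē' ≫ baseChangeHomFst (residueAt 𝔓) R.model.total = Spec.map (CommRingCat.ofHom (residueAt 𝔓)) ≫ e ∧
        ē' ≫ R.model.reductionAt.hom = 𝟙 _ := by
  refine ⟨pullback.lift (Spec.map (CommRingCat.ofHom (residueAt 𝔓)) ≫ e) (𝟙 _) ?_, pullback.lift_fst _ _ _,
    pullback.lift_snd _ _ _⟩
  rw [Category.assoc, he, Category.comp_id, Category.id_comp]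

include he hgen in
/-- The closed point of the zero section (in the special fibre) is fixed by the special fibre of every `R.liftEnd u`.
[cite: Shimura1998, §11.1 Prop. 12] -/
theorem specialPoint_comp_map_liftEnd_left (u : End A) (ē' : Spec (.of 𝔓.asIdeal.ResidueField) ⟶ R.model.reductionAt.left)
    (h₁ : ē' ≫ baseChangeHomFst (residueAt 𝔓) R.model.total = Spec.map (CommRingCat.ofHom (residueAt 𝔓)) ≫ e) :
    ē' ≫ ((baseChangeHom (residueAt 𝔓)).map (R.liftEnd u)).left = ē' := by
  apply pullback.hom_ext
  · change (ē' ≫ ((baseChangeHom (residueAt 𝔓)).map (R.liftEnd u)).left) ≫ baseChangeHomFst (residueAt 𝔓) R.model.total =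
      ē' ≫ baseChangeHomFst (residueAt 𝔓) R.model.total
    rw [Category.assoc, baseChangeHom_map_left_comp_fst, ← Category.assoc, h₁, Category.assoc,
      R.zeroSection_comp_liftEnd_left e he hgen u]
  · change (ē' ≫ ((baseChangeHom (residueAt 𝔓)).map (R.liftEnd u)).left) ≫ R.model.reductionAt.hom = ē' ≫ R.model.reductionAt.hom
    have hw : ((baseChangeHom (residueAt 𝔓)).map (R.liftEnd u)).left ≫ ((baseChangeHom (residueAt 𝔓)).obj R.model.total).hom =
        ((baseChangeHom (residueAt 𝔓)).obj R.model.total).hom := Over.w _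
    rw [Category.assoc]
    exact congrArg (fun t => ē' ≫ t) hw

include he hgen in
/-- The closed point of the zero section, read in the abelian variety `R.reduction` through `reductionIso⁻¹`, is fixed by the
reduction `R.redEnd u` of every endomorphism `u` of `A`. [cite: Shimura1998, §11.1 Prop. 12] -/
theorem specialPoint_comp_toSchemeHom_redEnd (u : End A) (ē' : Spec (.of 𝔓.asIdeal.ResidueField) ⟶ R.model.reductionAt.left)
    (h₁ : ē' ≫ baseChangeHomFst (residueAt 𝔓) R.model.total = Spec.map (CommRingCat.ofHom (residueAt 𝔓)) ≫ e) :
    (ē' ≫ R.reductionIso.inv.left) ≫ Hom.toSchemeHom (R.redEnd u : R.reduction ⟶ R.reduction) = ē' ≫ R.reductionIso.inv.left := by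
  have hih : R.reductionIso.inv.left ≫ R.reductionIso.hom.left = 𝟙 _ := by
    rw [← Over.comp_left, Iso.inv_hom_id, Over.id_left]
  have hhi : R.reductionIso.hom.left ≫ R.reductionIso.inv.left = 𝟙 _ := by
    rw [← Over.comp_left, Iso.hom_inv_id, Over.id_left]
  -- `redEnd u = reductionIso ∘ (liftEnd u)_κ ∘ reductionIso⁻¹` on underlying schemes
  have hred : Hom.toSchemeHom (R.redEnd u : R.reduction ⟶ R.reduction) =
      R.reductionIso.hom.left ≫ ((baseChangeHom (residueAt 𝔓)).map (R.liftEnd u)).left ≫ R.reductionIso.inv.left := by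
    calc Hom.toSchemeHom (R.redEnd u : R.reduction ⟶ R.reduction)
        = (Hom.toSchemeHom (R.redEnd u : R.reduction ⟶ R.reduction) ≫ R.reductionIso.hom.left) ≫ R.reductionIso.inv.left := by
            rw [Category.assoc, hhi, Category.comp_id]
      _ = R.reductionIso.hom.left ≫ ((baseChangeHom (residueAt 𝔓)).map (R.liftEnd u)).left ≫ R.reductionIso.inv.left := by
            rw [R.redEnd_left_comp u, Category.assoc]
  rw [hred, Category.assoc, reassoc_of% hih, ← Category.assoc, R.specialPoint_comp_map_liftEnd_left e he hgen u ē' h₁]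

include he hgen in
/-- **The origin pin.**  The closed point of the zero section, read in `R.reduction`, is the ORIGIN of the abelian variety
`R.reduction`: it is a `κ(𝔓)`-point fixed by `R.redEnd [2] = [2] = (𝟙)^2` (in the group of points), i.e. `x² = x`, so `x = 1`.
[cite: Shimura1998, §11.1 Prop. 12] [cite: BoschLutkebohmertRaynaud1990, §1.1] -/
theorem specialPoint_comp_reductionIso_inv_eq_unitPt (ē' : Spec (.of 𝔓.asIdeal.ResidueField) ⟶ R.model.reductionAt.left)
    (h₁ : ē' ≫ baseChangeHomFst (residueAt 𝔓) R.model.total = Spec.map (CommRingCat.ofHom (residueAt 𝔓)) ≫ e)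
    (h₂ : ē' ≫ R.model.reductionAt.hom = 𝟙 _) : ē' ≫ R.reductionIso.inv.left = unitPt R.reduction := by
  -- the point as a morphism of `κ`-schemes `T = (Spec κ, 𝟙) ⟶ R.reduction.X`
  let T : SchemeOver 𝔓.asIdeal.ResidueField := Over.mk (𝟙 (Spec (.of 𝔓.asIdeal.ResidueField)))
  have hx : (ē' ≫ R.reductionIso.inv.left) ≫ R.reduction.X.hom = T.hom := by
    change (ē' ≫ R.reductionIso.inv.left) ≫ R.reduction.X.hom = 𝟙 _
    rw [Category.assoc, Over.w R.reductionIso.inv, h₂]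
  let x : T ⟶ R.reduction.X := Over.homMk (ē' ≫ R.reductionIso.inv.left) hx
  -- `x ≫ [2] = x`, where `[2] = redEnd ((2 : ℤ) • 𝟙 A) = (2 : ℤ) • 𝟙 (R.reduction)` has underlying morphism `(𝟙)^2`
  have h1 : R.redEnd (𝟙 A) = 𝟙 R.reduction := R.redEnd_one
  have h2 : R.redEnd ((2 : ℤ) • 𝟙 A) = (2 : ℤ) • 𝟙 R.reduction := by
    rw [two_zsmul, two_zsmul, RingHom.map_add, h1]
  have hfix : x ≫ ((2 : ℤ) • 𝟙 R.reduction).hom.hom.hom = x := by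
    ext : 1
    change (ē' ≫ R.reductionIso.inv.left) ≫ Hom.toSchemeHom (((2 : ℤ) • 𝟙 R.reduction : End R.reduction) : R.reduction ⟶ R.reduction) =
      ē' ≫ R.reductionIso.inv.left
    rw [← h2]
    exact R.specialPoint_comp_toSchemeHom_redEnd e he hgen _ ē' h₁
  rw [hom_zsmul_id, GrpObj.comp_zpow, Category.comp_id] at hfix
  -- in the group of `T`-points: `x ^ 2 = x ⇒ x = 1`
  have hx1 : x = 1 := by
    have h' : x * x = x * 1 := by rw [mul_one, ← pow_two]; exact_mod_cast hfix
    exact mul_left_cancel h'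
  have hleft : x.left = (1 : T ⟶ R.reduction.X).left := congrArg (fun f => f.left) hx1
  rw [one_left] at hleft
  -- `x.left = ē' ≫ reductionIso⁻¹` by construction and `(1 : T ⟶ R.reduction.X).left = T.hom ≫ unitPt = 𝟙 ≫ unitPt`
  change x.left = unitPt R.reduction
  rw [hleft]
  exact Category.id_comp _

include he hgen in
/-- **The origin pin, in the shape consumed by the cotangent-lattice construction** (A-p03's `hsp`): the origin of `R.reduction`,
read in the model through `reductionIso` and the projection `reductionAt → R.model.total`, is the closed point
`Spec κ(𝔓) → Spec O → 𝒳` of the zero section. [cite: Shimura1998, §11.1 Prop. 12] [cite: BoschLutkebohmertRaynaud1990, §1.1] -/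
theorem unitPt_reduction_comp_eq :
    unitPt R.reduction ≫ R.reductionIso.hom.left ≫ baseChangeHomFst (residueAt 𝔓) R.model.total =
      Spec.map (CommRingCat.ofHom (residueAt 𝔓)) ≫ e := by
  obtain ⟨ē', h₁, h₂⟩ := R.exists_specialPoint e he
  have hih : R.reductionIso.inv.left ≫ R.reductionIso.hom.left = 𝟙 _ := by
    rw [← Over.comp_left, Iso.inv_hom_id, Over.id_left]
  rw [← R.specialPoint_comp_reductionIso_inv_eq_unitPt e he hgen ē' h₁ h₂, Category.assoc, reassoc_of% hih, h₁]

end GoodReductionAt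

end AbelianVariety

end Literature.AlgebraicGeometry.Motives

end
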